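import Summits.BirchSwinnertonDyer.Rank1Residual.X10.SecondDescentOneLine
import HarnessLib

/-!
# ONE second-descent line + an UPPER BOUND `#Ш[3] ≤ 9` (no `#Sel^(3) = 9` input) ⇒ `BSD(E,3)` — the door for Ш-cells whose `3`-Selmer group no engine computes directly (reducible `E[3]`: the (3, X3) programme) (cell `b2b-bsdres`, unit `b2b-bsdres-x10`, gen 51)

HONEST FRAMING (run/shared/lean/b2b/bsd-rank1-residual/, verbatim in every file): the goal of the
cell is to DELETE the COMBINATION-SHAPED residual classes of the Birch–Swinnerton-Dyer formula for
ALL analytic-rank `≤ 1` elliptic curves over `ℚ` — "full BSD formula for every rank `≤ 1` curve in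
class `C`" assembled STRICTLY from published theorems — so that the rank-`≤ 1` remainder becomes
exactly the CONSTRUCTION-SHAPED classes, which are TYPED (missing-input `Prop`s), NOT attempted.
This is not "finishing BSD". Theorems only (no definition, no new named fact); NOTHING IS BOOKED
here; no class label changes (X3 stays CONSTRUCTION-SHAPED at class level; X10b stays
CONSTRUCTION-SHAPED / NEEDS X_A3). Per pair.

**What this file is.** `X10/SecondDescentOneLine.lean` (p685094) turns ONE second-3-descent
EMPTINESS line `h1 : ∃ x : Ш, 3•x = 0 ∧ x ≠ 0 ∧ ∀ z, 3•z ≠ x` into `Ш[9] = Ш[3]` under bsd.S18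
(`hCT`), GIVEN `#Sel^(3)(E/ℚ) = 9` (`hcard`, two 3-descent engines). For a rank-`0` curve with
REDUCIBLE `E[3]` (a rational 3-isogeny `φ : E → E'`) no engine of the cell computes `#Sel^(3)`
(`desc3lib` / `desc3full` refuse a reducible `ψ₃`), but the FIRST ISOGENY DESCENTS give an UPPER
BOUND: `0 → Ш(E)[φ] → Ш(E)[3] → Ш(E')[φ̂]` is exact, so `#Ш(E)[3] ≤ #Ш(E)[φ] · #Ш(E')[φ̂] = 3^{a+b}`
(`a`, `b` from the exact `φ`- / `φ̂`-Selmer groups: kit `isodesc3`, X10-AUDIT §57.4; on the 159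
"Case B" classes of the (3,X3) census `a = b = 1`). This file proves that the upper bound SUFFICES:
* `natCard_torsionBy_eq_sq_of_le_of_ne_zero` (§1, pure algebra): a finite additive group with an
  alternating non-degenerate `ℚ/ℤ`-pairing has `#A[p] = p^{2k}` (tree:
  `Literature.GroupTheory.FiniteAbelian.exists_natCard_torsionBy_eq_pow_two_mul_of_circle` — Cassels'
  "the order of Ш is a square", level `p`); so `#A[p] ≤ p²` together with ONE non-zero `p`-torsion
  element forces `#A[p] = p²` EXACTLY;
* `sq_nsmul_stable_of_oneNonDivisible_of_card_le`: hence the one-line theorem of the companion file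
  applies: ONE non-divisible non-zero `x₀ ∈ A[p]` ⇒ `A[p²] = A[p]`;
* `card_selmerGroup_eq_sq_of_oneNonDivisible_of_card_le` (§2, rank `0`, `p ∤ #E(K)_tors`, `Ш`
  finite): the `p`-descent count `#Sel^(p)(E/K) = p²` is then a CONSEQUENCE (p213922's proved
  bijection `Sel^(p) ≅ Ш[p]`), not an input;
* `bsdp_of_oneNonDivisible_of_card_le` / `padicValNat_shaOrder_eq_two_of_oneNonDivisible_of_card_le`
  (§3, over `ℚ`, GZK) and the record shape `bsdp_three_of_oneNonDivisible_of_card_le` (§4: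
  `p = 3`; `3 ∤ #E(ℚ)_tors` DISPLAYED — for a reducible `E[3]` it is NOT a consequence of
  a Frobenius no-root witness; the desk prices it as it prices Cremona's torsion column, or a later
  kernel certificate discharges it).

**Displayed binders of the record shape:** `hCT` (bsd.S18), `hGZK`, `hr : r_an = 0`,
`htors : 3 ∤ #E(ℚ)_tors`, `hub : #Ш(E/ℚ)[3] ≤ 9` (= two-engine exact isogeny descents `a + b ≤ 2`
and the exact sequence above — kit `isodesc3`: model `Y² = X³ + D(aX+b)²`, Kummer map
`Y − √D(aX+b)` into `(ℚ(√D)×/cubes)_{N≡1}`, local images certified complete by Tate duality,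
Cassels' formula as self-test), `h1` (= ONE route-C9 second-3-descent EMPTINESS pair on the plane
cubic `D_α` of an isogeny Selmer element `α ∈ Sel^φ(E)` — `ninedesc` r6 "étale", flex algebra
split `3 + 6` / `3 + 3 + 3`, every field of degree `≤ 6`; EMPTY ⇒ `D_α(ℚ) = ∅` and
`[D_α] ∉ 3·Ш`), `hq`/`hv : ord₃ #Ш_an = 2`. First instances (engine 1 only, X10-AUDIT §57.5):
7632m1 (`D_α : −2x³ + (−21y + 228w)x² + 6y²x + 7y³ + 228wy² + 256w³`, EMPTY), 17442g1, with the
controls 378a3 / 1026m3 (BSD(E,3) a theorem; 12/13 classes EMPTY, the 13th = the torsion line) and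
91b1 (rank 1: 4/4 consistent).

References: Cassels 1962 (IV) [Cassels1962ArithmeticIV]; Silverman AEC X.4.14, X.4.2
[SilvermanAEC2009]; B. Creutz, Math. Comp. 83 (2014) Thm. 7.2 [Creutz2014]; B. Creutz & R. L. Miller,
J. Algebra 372 (2012) §2 (5-term sequence of a `3`-isogeny) [CreutzMiller2012]; E. F. Schaefer &
M. Stoll, Trans. AMS 356 (2004) [SchaeferStoll2004]; R. L. Miller 2011 Def. 1.1 [Miller2011LMS];
companions `X10/SecondDescentOneLine` (p685094), `X10/SecondDescentNine` (p556861),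
`X10/CasselsTatePairingCertificate` (p213922); cell files X10-AUDIT.md §57.4–§57.5, `g51/C9-NEXT.md`.
-/

set_option autoImplicit false

noncomputable section

open scoped Classical AddSubgroup

open WeierstrassCurve Literature.NumberTheory.EllipticCurves
  Literature.NumberTheory.EllipticCurves.Rank1Residual
  Literature.NumberTheory.EllipticCurves.Rank1Residual.Typed
  Literature.NumberTheory.EllipticCurves.Rank1Residual.X11RankOneCertificates
  Literature.GroupTheory.FiniteAbelian
  Summit.BirchSwinnertonDyer.BirchSwinnertonDyer.Rank1Residual.IntModel
  Summit.BirchSwinnertonDyer.BirchSwinnertonDyer.Rank1Residual.X11RankOne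
  Summit.BirchSwinnertonDyer.Rank1Residual.X11b

namespace Summit.BirchSwinnertonDyer.Rank1Residual.X10

/-! ### §1 Algebra: `#A[p] ≤ p²` plus one non-zero `p`-torsion element gives `#A[p] = p²` under an alternating non-degenerate `ℚ/ℤ`-pairing -/

section Algebra

variable {A : Type*} [AddCommGroup A]

/-- **`#A[p] = p²` from the upper bound `#A[p] ≤ p²` and one non-zero `p`-torsion element**, for a
finite additive group with an alternating non-degenerate bi-additive `ℚ/ℤ`-pairing: `#A[p] = p^{2k}`
(Cassels' squareness at level `p`, tree lemma `exists_natCard_torsionBy_eq_pow_two_mul_of_circle`),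
`k ≥ 1` because `A[p] ∋ x₀ ≠ 0`, `k ≤ 1` by the bound. [cite: Cassels1962ArithmeticIV]
[cite: SilvermanAEC2009, Thm. X.4.14] -/
theorem natCard_torsionBy_eq_sq_of_le_of_ne_zero [Finite A] (B : A →+ A →+ AddCircle (1 : ℚ))
    (halt : ∀ x, B x x = 0) (hnd : ∀ x, (∀ y, B x y = 0) → x = 0) (p : ℕ) [hp : Fact p.Prime]
    (hub : Nat.card (AddSubgroup.torsionBy A p) ≤ p ^ 2)
    {x₀ : A} (hx₀ : p • x₀ = 0) (hx₀ne : x₀ ≠ 0) :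
    Nat.card (AddSubgroup.torsionBy A p) = p ^ 2 := by
  obtain ⟨k, hk⟩ := exists_natCard_torsionBy_eq_pow_two_mul_of_circle p A B halt hnd
  have hk' : Nat.card (AddSubgroup.torsionBy A p) = p ^ (2 * k) := hk
  have hp1 : 1 < p := hp.out.one_lt
  -- `k ≥ 1`: the subgroup `A[p]` has the two distinct elements `0` and `x₀`
  have hmem : x₀ ∈ AddSubgroup.torsionBy A p := AddSubgroup.torsionBy.nsmul_iff.mpr hx₀
  have htwo : 1 < Nat.card (AddSubgroup.torsionBy A p) := by
    haveI : Finite (AddSubgroup.torsionBy A p) := inferInstance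
    rw [Finite.one_lt_card_iff_nontrivial]
    exact ⟨⟨⟨x₀, hmem⟩, ⟨0, zero_mem _⟩, fun h => hx₀ne (congrArg Subtype.val h)⟩⟩
  have hk1 : 1 ≤ k := by
    by_contra h
    have hk0 : k = 0 := by omega
    rw [hk', hk0, mul_zero, pow_zero] at htwo
    exact lt_irrefl _ htwo
  -- `k ≤ 1`: the bound
  have hk2 : k ≤ 1 := by
    by_contra h
    have h4 : 2 * 2 ≤ 2 * k := by omega
    have : p ^ (2 * 2) ≤ p ^ (2 * k) := Nat.pow_le_pow_right hp.out.pos h4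
    rw [← hk'] at this
    have : p ^ 4 ≤ p ^ 2 := this.trans hub
    have : p ^ 2 < p ^ 4 := Nat.pow_lt_pow_right hp1 (by norm_num)
    omega
  have hk11 : k = 1 := le_antisymm hk2 hk1
  rw [hk', hk11]

/-- **ONE non-divisible non-zero `p`-torsion element + `#A[p] ≤ p²` ⇒ `A[p²] = A[p]`** (finite `A`,
alternating non-degenerate `ℚ/ℤ`-pairing): §1 and `sq_nsmul_stable_of_oneNonDivisible`.
[cite: Cassels1962ArithmeticIV] [cite: Cassels1998, §1] -/
theorem sq_nsmul_stable_of_oneNonDivisible_of_card_le [Finite A] (B : A →+ A →+ AddCircle (1 : ℚ))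
    (halt : ∀ x, B x x = 0) (hnd : ∀ x, (∀ y, B x y = 0) → x = 0) {p : ℕ} [Fact p.Prime]
    (hub : Nat.card (AddSubgroup.torsionBy A p) ≤ p ^ 2)
    (h1 : ∃ x : A, p • x = 0 ∧ x ≠ 0 ∧ ∀ z : A, p • z ≠ x) :
    ∀ x : A, p ^ 2 • x = 0 → p • x = 0 := by
  obtain ⟨x₀, hx₀, hx₀ne, hx₀nd⟩ := h1
  exact sq_nsmul_stable_of_oneNonDivisible B halt hnd
    (natCard_torsionBy_eq_sq_of_le_of_ne_zero B halt hnd p hub hx₀ hx₀ne) ⟨x₀, hx₀, hx₀ne, hx₀nd⟩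

end Algebra

/-! ### §2 Rank `0` over a number field: the `p`-descent count is a CONSEQUENCE -/

section General

variable {K : Type*} [Field K] [NumberField K] (W : WeierstrassCurve K) [W.IsElliptic]

/-- **`#Sel^(p)(E/K) = p²` from bsd.S18, the bound `#Ш[p] ≤ p²` and ONE non-zero `p`-torsion class
of `Ш`** (rank `0`, `p ∤ #E(K)_tors`, `Ш` finite): `#Ш[p] = p²` by §1 and `#Ш[p] = #Sel^(p)` by
p213922's proved bijection. [cite: SilvermanAEC2009, Thm. X.4.14 and Thm. X.4.2(a)] -/
theorem card_selmerGroup_eq_sq_of_ne_zero_of_card_le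
    (hCT : exists_casselsTate_pairing (K := K)) [Finite W.sha] (p : ℕ) [Fact p.Prime]
    (hrank : W.mordellWeilRank = 0) (htors : ¬ p ∣ W.torsionOrder)
    (hub : Nat.card (AddSubgroup.torsionBy W.sha p) ≤ p ^ 2)
    {x₀ : W.sha} (hx₀ : p • x₀ = 0) (hx₀ne : x₀ ≠ 0) :
    Nat.card (W.selmerGroup (p : ℤ)) = p ^ 2 := by
  obtain ⟨B, halt, hker⟩ := hCT W
  have hnd : ∀ x : W.sha, (∀ y, B x y = 0) → x = 0 := fun x hx => by
    have hmem : x ∈ AddSubgroup.divisibleElements W.sha := (hker x).mp hx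
    rwa [divisibleElements_eq_bot_of_finite, AddSubgroup.mem_bot] at hmem
  rw [← card_sha_inf_torsionBy_eq_card_selmerGroup_of_rankZero W p hrank htors,
    ← card_torsionBy_coe_eq_card_inf]
  exact natCard_torsionBy_eq_sq_of_le_of_ne_zero B halt hnd p hub hx₀ hx₀ne

/-- **`Ш(E/K)[p²] = Ш(E/K)[p]` from bsd.S18, `#Ш[p] ≤ p²` and ONE non-divisible non-zero
`p`-torsion class.** [cite: Cassels1962ArithmeticIV] [cite: Creutz2014, Thm. 7.2] -/
theorem shaNoPSqTorsion_of_oneNonDivisible_of_card_le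
    (hCT : exists_casselsTate_pairing (K := K)) [Finite W.sha] (p : ℕ) [Fact p.Prime]
    (hub : Nat.card (AddSubgroup.torsionBy W.sha p) ≤ p ^ 2)
    (h1 : ∃ x : W.sha, p • x = 0 ∧ x ≠ 0 ∧ ∀ z : W.sha, p • z ≠ x) :
    ∀ x : W.sha, p ^ 2 • x = 0 → p • x = 0 := by
  obtain ⟨B, halt, hker⟩ := hCT W
  have hnd : ∀ x : W.sha, (∀ y, B x y = 0) → x = 0 := fun x hx => by
    have hmem : x ∈ AddSubgroup.divisibleElements W.sha := (hker x).mp hx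
    rwa [divisibleElements_eq_bot_of_finite, AddSubgroup.mem_bot] at hmem
  exact sq_nsmul_stable_of_oneNonDivisible_of_card_le B halt hnd hub h1

end General

/-! ### §3 Over `ℚ`: Miller's `BSD(E,p)` from GZK + bsd.S18 + `#Ш[p] ≤ p²` + ONE line -/

section OverQ

variable (W : WeierstrassCurve ℚ) [W.IsElliptic] (p : ℕ) [Fact p.Prime]

/-- **`BSD(E,p)` at a rank-`0` pair from the Cassels–Tate pairing fact, the bound `#Ш[p] ≤ p²`,
`p ∤ #E(ℚ)_tors`, ONE non-divisible non-zero `p`-torsion class of `Ш`, and `ord_p #Ш_an = 2`.**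
The `p`-descent count `#Sel^(p) = p²` is derived (§2), not assumed. Class-free, image-free; per curve.
[cite: Creutz2014, Thm. 7.2] [cite: Cassels1962ArithmeticIV] [cite: Miller2011LMS, §1 and Def. 1.1]
[cite: SilvermanAEC2009, Thm X.4.2(a) and Thm. X.4.14] -/
theorem bsdp_of_oneNonDivisible_of_card_le
    (hCT : exists_casselsTate_pairing (K := ℚ)) (hGZK : rank_eq_analyticRank_of_analyticRank_le_one)
    (hr : W.analyticRank = 0) (htors : ¬ p ∣ W.torsionOrder)
    (hub : Nat.card (AddSubgroup.torsionBy W.sha p) ≤ p ^ 2)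
    (h1 : ∃ x : W.sha, p • x = 0 ∧ x ≠ 0 ∧ ∀ z : W.sha, p • z ≠ x)
    {q : ℚ} (hq : shaAn W = (q : ℂ)) (hv : padicValRat p q = 2) : BSDp W p := by
  have hr1 : W.analyticRank ≤ 1 := by rw [hr]; norm_num
  have hrank : W.mordellWeilRank = 0 := by rw [(hGZK W hr1).1, hr]
  haveI : Finite W.sha := (hGZK W hr1).2
  obtain ⟨x₀, hx₀, hx₀ne, hx₀nd⟩ := h1
  have hcard : Nat.card (W.selmerGroup (p : ℤ)) = p ^ 2 :=
    card_selmerGroup_eq_sq_of_ne_zero_of_card_le W hCT p hrank htors hub hx₀ hx₀ne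
  exact bsdp_of_oneNonDivisible_of_card_selmerGroup W p hCT hGZK hr htors hcard ⟨x₀, hx₀, hx₀ne, hx₀nd⟩ hq hv

/-- **The exact `p`-part on such a pair: `ord_p #Ш(E/ℚ) = 2`.**
[cite: Cassels1962ArithmeticIV] [cite: SilvermanAEC2009, Thm X.4.2(a)] -/
theorem padicValNat_shaOrder_eq_two_of_oneNonDivisible_of_card_le
    (hCT : exists_casselsTate_pairing (K := ℚ)) (hGZK : rank_eq_analyticRank_of_analyticRank_le_one)
    (hr : W.analyticRank = 0) (htors : ¬ p ∣ W.torsionOrder)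
    (hub : Nat.card (AddSubgroup.torsionBy W.sha p) ≤ p ^ 2)
    (h1 : ∃ x : W.sha, p • x = 0 ∧ x ≠ 0 ∧ ∀ z : W.sha, p • z ≠ x) :
    padicValNat p W.shaOrder = 2 := by
  have hr1 : W.analyticRank ≤ 1 := by rw [hr]; norm_num
  have hrank : W.mordellWeilRank = 0 := by rw [(hGZK W hr1).1, hr]
  haveI : Finite W.sha := (hGZK W hr1).2
  obtain ⟨x₀, hx₀, hx₀ne, hx₀nd⟩ := h1
  have hcard : Nat.card (W.selmerGroup (p : ℤ)) = p ^ 2 :=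
    card_selmerGroup_eq_sq_of_ne_zero_of_card_le W hCT p hrank htors hub hx₀ hx₀ne
  exact padicValNat_shaOrder_eq_two_of_oneNonDivisible W p hCT hGZK hr htors hcard ⟨x₀, hx₀, hx₀ne, hx₀nd⟩

end OverQ

/-! ### §4 The record shape at `p = 3` with `3 ∤ #E(ℚ)_tors` DISPLAYED (reducible `E[3]`; the record substitutes the literal model `W = ⟨a₁,…,a₆⟩` and decides `Δ ≠ 0`) -/

/-- **`BSD(E,3)` from the literal model + bsd.S18 + `3 ∤ #E(ℚ)_tors` + `#Ш[3] ≤ 9` + ONE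
second-3-descent emptiness pair.** For an elliptic `W/ℚ` (the record substitutes Cremona's model and
decides `Δ ≠ 0` in the kernel), analytic rank `0`, `3 ∤ #E(ℚ)_tors`
(displayed: for a reducible `E[3]` no Frobenius witness gives it), the bound `#Ш[3] ≤ 9` (two-engine
exact isogeny descents), ONE non-zero class of `Ш[3]` not divisible by `3` (`h1`: the EMPTY second
descent of an isogeny covering) and `ord₃ #Ш_an = 2`: Miller's `BSD(E,3)`. Per pair; not a class
theorem; books nothing. [cite: Creutz2014, Thm. 7.2 and Alg. 7.3] [cite: Cassels1962ArithmeticIV]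
[cite: Miller2011LMS, Def. 1.1] [cite: SilvermanAEC2009, Thm X.4.2(a) and Thm. X.4.14] -/
theorem bsdp_three_of_oneNonDivisible_of_card_le
    (hCT : exists_casselsTate_pairing (K := ℚ)) (hGZK : rank_eq_analyticRank_of_analyticRank_le_one)
    (W : WeierstrassCurve ℚ) [W.IsElliptic]
    (hr : W.analyticRank = 0) (htors : ¬ 3 ∣ W.torsionOrder)
    (hub : Nat.card (AddSubgroup.torsionBy W.sha 3) ≤ 9)
    (h1 : ∃ x : W.sha, 3 • x = 0 ∧ x ≠ 0 ∧ ∀ z : W.sha, 3 • z ≠ x)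
    {q : ℚ} (hq : shaAn W = (q : ℂ)) (hv : padicValRat 3 q = 2) : BSDp W 3 := by
  haveI : Fact (Nat.Prime 3) := ⟨by norm_num⟩
  exact bsdp_of_oneNonDivisible_of_card_le W 3 hCT hGZK hr htors
    (by rw [show (3 : ℕ) ^ 2 = 9 by norm_num]; exact hub) h1 hq hv

/-- **The exact `3`-part under the same data: `ord₃ #Ш(E/ℚ) = 2`** (`#Ш(E/ℚ)[3^∞] = 9`).
[cite: Cassels1962ArithmeticIV] [cite: SilvermanAEC2009, Thm X.4.2(a)] -/
theorem padicValNat_shaOrder_three_eq_two_of_oneNonDivisible_of_card_le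
    (hCT : exists_casselsTate_pairing (K := ℚ)) (hGZK : rank_eq_analyticRank_of_analyticRank_le_one)
    (W : WeierstrassCurve ℚ) [W.IsElliptic]
    (hr : W.analyticRank = 0) (htors : ¬ 3 ∣ W.torsionOrder)
    (hub : Nat.card (AddSubgroup.torsionBy W.sha 3) ≤ 9)
    (h1 : ∃ x : W.sha, 3 • x = 0 ∧ x ≠ 0 ∧ ∀ z : W.sha, 3 • z ≠ x) :
    padicValNat 3 W.shaOrder = 2 := by
  haveI : Fact (Nat.Prime 3) := ⟨by norm_num⟩
  exact padicValNat_shaOrder_eq_two_of_oneNonDivisible_of_card_le W 3 hCT hGZK hr htors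
    (by rw [show (3 : ℕ) ^ 2 = 9 by norm_num]; exact hub) h1

/-! ### §5 (appended, x10 GEN 51) The torsion binder in RATIONAL-POINT form: "no rational point of order 3" — stateable for a literal model without an ellipticity instance, kernel-decidable later -/

section NoRationalThreeTorsion

variable (W : WeierstrassCurve ℚ) [W.IsElliptic]

/-- **`(∀ P ∈ E(ℚ), 3P = 0 → P = 0) ⟹ 3 ∤ #E(ℚ)_tors`**: Cauchy's theorem in the finite group
`E(ℚ)_tors` (an element of order `3` would be a rational point killed by `3`). The hypothesis is the
form a record can DISPLAY for a literal model (no instance needed to state it) and a later kernel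
certificate (division polynomial) can discharge. [cite: SilvermanAEC2009, VII.3 and VIII.§1] -/
theorem not_three_dvd_torsionOrder_of_forall_point (p : ℕ) [Fact p.Prime]
    (hno : ∀ P : W.toAffine.Point, p • P = 0 → P = 0) : ¬ p ∣ W.torsionOrder := by
  haveI : Finite (AddCommGroup.torsion W.toAffine.Point) := by convert W.finite_torsion_holds
  have hcard : W.torsionOrder = Nat.card (AddCommGroup.torsion W.toAffine.Point) := by
    unfold WeierstrassCurve.torsionOrder
    congr!
  intro hdvd
  rw [hcard] at hdvd
  obtain ⟨T, hT⟩ :=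
    exists_prime_addOrderOf_dvd_card' (G := AddCommGroup.torsion W.toAffine.Point) p hdvd
  have hp1 : p ≠ 1 := (Fact.out : p.Prime).ne_one
  have hpT : p • (T : W.toAffine.Point) = 0 := by
    have h := addOrderOf_nsmul_eq_zero T
    rw [hT] at h
    exact_mod_cast congrArg Subtype.val h
  have hT0 : (T : W.toAffine.Point) = 0 := hno _ hpT
  have hT1 : addOrderOf T = 1 := by
    rw [show T = 0 from Subtype.ext hT0, addOrderOf_zero]
  exact hp1 (hT.symm.trans hT1)

/-- **The C9-RED record shape** (`p = 3`): bsd.S18, GZK, analytic rank `0`, NO RATIONAL POINT OF ORDER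
`3` (displayed; Cremona's torsion column, kernel-decidable), `#Ш[3] ≤ 9` (two-engine exact 3-isogeny
descents), ONE non-divisible non-zero class of `Ш[3]` (two-engine EMPTY second 3-descent on a minimised
isogeny cubic), `ord₃ #Ш_an = 2` ⇒ Miller's `BSD(E,3)`. Per pair; books nothing.
[cite: Creutz2014, Thm. 7.2 and Alg. 7.3] [cite: Cassels1962ArithmeticIV] [cite: Miller2011LMS, Def. 1.1]
[cite: SilvermanAEC2009, Thm X.4.2(a) and Thm. X.4.14] -/
theorem bsdp_three_of_oneNonDivisible_of_card_le_of_noRationalThreeTorsion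
    (hCT : exists_casselsTate_pairing (K := ℚ)) (hGZK : rank_eq_analyticRank_of_analyticRank_le_one)
    (hr : W.analyticRank = 0) (hno : ∀ P : W.toAffine.Point, 3 • P = 0 → P = 0)
    (hub : Nat.card (AddSubgroup.torsionBy W.sha 3) ≤ 9)
    (h1 : ∃ x : W.sha, 3 • x = 0 ∧ x ≠ 0 ∧ ∀ z : W.sha, 3 • z ≠ x)
    {q : ℚ} (hq : shaAn W = (q : ℂ)) (hv : padicValRat 3 q = 2) : BSDp W 3 :=
  haveI : Fact (Nat.Prime 3) := ⟨by norm_num⟩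
  bsdp_three_of_oneNonDivisible_of_card_le hCT hGZK W hr
    (not_three_dvd_torsionOrder_of_forall_point W 3 hno) hub h1 hq hv

/-- The exact `3`-part under the same data: `ord₃ #Ш(E/ℚ) = 2`. [cite: Cassels1962ArithmeticIV] [cite: SilvermanAEC2009, Thm X.4.2(a)] -/
theorem padicValNat_shaOrder_three_eq_two_of_oneNonDivisible_of_card_le_of_noRationalThreeTorsion
    (hCT : exists_casselsTate_pairing (K := ℚ)) (hGZK : rank_eq_analyticRank_of_analyticRank_le_one)
    (hr : W.analyticRank = 0) (hno : ∀ P : W.toAffine.Point, 3 • P = 0 → P = 0)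
    (hub : Nat.card (AddSubgroup.torsionBy W.sha 3) ≤ 9)
    (h1 : ∃ x : W.sha, 3 • x = 0 ∧ x ≠ 0 ∧ ∀ z : W.sha, 3 • z ≠ x) :
    padicValNat 3 W.shaOrder = 2 :=
  haveI : Fact (Nat.Prime 3) := ⟨by norm_num⟩
  padicValNat_shaOrder_three_eq_two_of_oneNonDivisible_of_card_le hCT hGZK W hr
    (not_three_dvd_torsionOrder_of_forall_point W 3 hno) hub h1

end NoRationalThreeTorsion

end Summit.BirchSwinnertonDyer.Rank1Residual.X10

end
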